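import Summits.Parity.GeneralizedHardyLittlewood.Theorems.PrimeLevelFamEdgeMomentsBeyondDiagonalDiagDecorOrderHecke
import Summits.Parity.GeneralizedHardyLittlewood.Theorems.PrimeLevelFamEdgeMomentsBeyondDiagonalDiagDecorWeightRungTwo
import HarnessLib

/-!
# Route `PrimeLevelFamEdge`, crux K_A `MomentsBeyondDiagonal` (stmt-Parity-20007), line «petersson_layers» v4, stub `stub_diag`:
# **RUNG 2 of the ladder, the Hecke-summed weights EXPLICITLY: orders `(0,2)` and `(2,2)` (and `(2,0)`) in the product format
# `τ(k₁)τ(k₂)·{…}` of `…DiagDecorOrderOneOneHecke`**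

By `…DiagOrderSymm.subDiag_of_selbergOrderAsymptotics_of_le` rung `N = 2` of `stub_diag` consists of the orders `(0,2)` and
`(2,2)`. Instantiating `…DiagDecorOrderHecke.heckeSum_order_eq` with the closed forms of `…DiagDecorWeightGeneric` /
`…DiagDecorWeightRungTwo` (`L = 2(log Q − log g) − log k₁ − log k₂`, `S₂ = P₂(k₁)+P₂(k₂)`, `S₄ = P₄(k₁)+P₄(k₂)`,
`P_m(k) = Σ_{p∣k}log^m p`, `c_{ab} = c_{ab}(g²k₁k₂/Q²)` the Bose coefficients, squarefree `k₁, k₂`, `Q > 0`, `g ≥ 1`):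

* `heckeSum_orderTwoZero_eq` — `Σ_{d,e}𝔚₂₀ = ττ·{(L² + S₂)/4·c₀₀ + L·c₁₀ + c₂₀}`;
* `heckeSum_orderZeroTwo_eq` — **`Σ_{d,e}𝔚₀₂ = ττ·{(L² + S₂)/4·c₀₀ + L·c₀₁ + c₀₂}`** — decorations `ττ`, `τP₂·τ` only: every
  monomial of its polynomial part is covered by the landed engines `…DiagDecorShiftedLpow.abs_selbergLpow_sub_le` and
  `…DiagDecorShiftedP2Lpow.abs_selbergP2Lpow_sub_le`;
* `heckeSum_orderTwoTwo_eq` — **`Σ_{d,e}𝔚₂₂ = ττ·{(L⁴ − 2L²S₂ + 3S₂² − 2S₄)/16·c₀₀ + (L³ − LS₂)/4·(c₀₁ + c₁₀)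
  + (L² + S₂)/4·(c₀₂ + c₂₀) + (L² − S₂)·c₁₁ + L·(c₁₂ + c₂₁) + c₂₂}`** — new decorations `τP₂(k₁)·τP₂(k₂)` (two-sided),
  `τP₂²`, `τP₄` (in `S₂²`, `S₄`).

Pointwise identities (the Selberg-form versions follow by `…DiagDecorWeightOneOne.selbergForm_congr_squarefree` exactly as in
`…DiagDecorOrderOneOneHecke.selbergOrderOneOne_hecke_eq`). Def-free; theorems only. Helper `--supports stmt-Parity-20007`;
closes nothing; K_A, K_B and the Parity summit are NOT proved; nothing about Landau–Siegel zeros.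

## References
* E. Kowalski, P. Michel, J. VanderKam, J. reine angew. Math. 526 (2000), (21)–(28) pp. 12–15.
  [cite: KowalskiMichelVanderKam2000, (23)–(28) — derivation (Hecke-divisor bookkeeping of the order-(i,j) diagonal weight)]
-/

noncomputable section

open scoped Real ArithmeticFunction.Moebius
open Finset ArithmeticFunction Polynomial MeasureTheory Set

namespace Summit.Parity.GeneralizedHardyLittlewood.Theorems.MomentsBeyondDiagonal.DiagKernel

open Literature.NumberTheory.LFunctions Literature.NumberTheory.LFunctions.KMV2000

/-- **Order `(2,0)`**: `Σ_{d,e}𝔚₂₀ = τ(k₁)τ(k₂)·{(L² + S₂)/4·c₀₀ + L·c₁₀ + c₂₀}(g²k₁k₂/Q²)` (`Q > 0`, `g ≥ 1`, squarefree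
`k₁, k₂`). [cite: KowalskiMichelVanderKam2000, (23)–(28) — derivation] -/
theorem heckeSum_orderTwoZero_eq {Q : ℝ} (hQ : 0 < Q) {g k₁ k₂ : ℕ} (hg : g ≠ 0) (hk₁ : Squarefree k₁)
    (hk₂ : Squarefree k₂) :
    ∑ d ∈ k₁.divisors, ∑ e ∈ k₂.divisors,
        ∫ u₁ in Ioi (0 : ℝ),
          (Real.log (Q / ((k₁ / d * (g * e) : ℕ) : ℝ)) + Real.log u₁) ^ 2 *
          ∫ u₂ in Ioi ((((k₁ / d * (g * e) * (g * d * (k₂ / e)) : ℕ) : ℝ) / Q ^ 2) / u₁),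
            Real.exp (-(u₁ + u₂)) / (1 - Real.exp (-(u₁ + u₂))) ^ 2 *
            (Real.log (Q / ((g * d * (k₂ / e) : ℕ) : ℝ)) + Real.log u₂) ^ 0 =
      (k₁.divisors.card : ℝ) * (k₂.divisors.card : ℝ) *
        (((2 * (Real.log Q - Real.log g) - Real.log k₁ - Real.log k₂) ^ 2 +
            ((∑ p ∈ k₁.primeFactors, Real.log p ^ 2) + ∑ p ∈ k₂.primeFactors, Real.log p ^ 2)) / 4 *
          (∫ u₁ in Ioi (0 : ℝ), ∫ u₂ in Ioi ((((g * g * (k₁ * k₂) : ℕ) : ℝ) / Q ^ 2) / u₁),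
            Real.exp (-(u₁ + u₂)) / (1 - Real.exp (-(u₁ + u₂))) ^ 2) +
        (2 * (Real.log Q - Real.log g) - Real.log k₁ - Real.log k₂) *
          (∫ u₁ in Ioi (0 : ℝ), Real.log u₁ * ∫ u₂ in Ioi ((((g * g * (k₁ * k₂) : ℕ) : ℝ) / Q ^ 2) / u₁),
            Real.exp (-(u₁ + u₂)) / (1 - Real.exp (-(u₁ + u₂))) ^ 2) +
        ∫ u₁ in Ioi (0 : ℝ), Real.log u₁ ^ 2 * ∫ u₂ in Ioi ((((g * g * (k₁ * k₂) : ℕ) : ℝ) / Q ^ 2) / u₁),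
            Real.exp (-(u₁ + u₂)) / (1 - Real.exp (-(u₁ + u₂))) ^ 2) := by
  rw [heckeSum_order_eq 2 0 hQ hg hk₁.ne_zero hk₂.ne_zero]
  simp only [Finset.sum_range_succ, Finset.sum_range_zero, zero_add, Nat.sub_self, Nat.sub_zero,
    Nat.choose_zero_right, Nat.choose_self, Nat.choose_one_right, Nat.succ_sub_succ_eq_sub,
    centralMoment_zero, centralMoment_one, centralMoment_two_of_squarefree hk₁, centralMoment_two_of_squarefree hk₂]
  simp only [pow_zero, pow_one, one_mul, mul_one]
  push_cast
  ring

/-- **Order `(0,2)` (rung 2)**: `Σ_{d,e}𝔚₀₂ = τ(k₁)τ(k₂)·{(L² + S₂)/4·c₀₀ + L·c₀₁ + c₀₂}(g²k₁k₂/Q²)` (`Q > 0`, `g ≥ 1`,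
squarefree `k₁, k₂`); decorations `ττ` and `τP₂·τ` only. [cite: KowalskiMichelVanderKam2000, (23)–(28) — derivation] -/
theorem heckeSum_orderZeroTwo_eq {Q : ℝ} (hQ : 0 < Q) {g k₁ k₂ : ℕ} (hg : g ≠ 0) (hk₁ : Squarefree k₁)
    (hk₂ : Squarefree k₂) :
    ∑ d ∈ k₁.divisors, ∑ e ∈ k₂.divisors,
        ∫ u₁ in Ioi (0 : ℝ),
          (Real.log (Q / ((k₁ / d * (g * e) : ℕ) : ℝ)) + Real.log u₁) ^ 0 *
          ∫ u₂ in Ioi ((((k₁ / d * (g * e) * (g * d * (k₂ / e)) : ℕ) : ℝ) / Q ^ 2) / u₁),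
            Real.exp (-(u₁ + u₂)) / (1 - Real.exp (-(u₁ + u₂))) ^ 2 *
            (Real.log (Q / ((g * d * (k₂ / e) : ℕ) : ℝ)) + Real.log u₂) ^ 2 =
      (k₁.divisors.card : ℝ) * (k₂.divisors.card : ℝ) *
        (((2 * (Real.log Q - Real.log g) - Real.log k₁ - Real.log k₂) ^ 2 +
            ((∑ p ∈ k₁.primeFactors, Real.log p ^ 2) + ∑ p ∈ k₂.primeFactors, Real.log p ^ 2)) / 4 *
          (∫ u₁ in Ioi (0 : ℝ), ∫ u₂ in Ioi ((((g * g * (k₁ * k₂) : ℕ) : ℝ) / Q ^ 2) / u₁),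
            Real.exp (-(u₁ + u₂)) / (1 - Real.exp (-(u₁ + u₂))) ^ 2) +
        (2 * (Real.log Q - Real.log g) - Real.log k₁ - Real.log k₂) *
          (∫ u₁ in Ioi (0 : ℝ), ∫ u₂ in Ioi ((((g * g * (k₁ * k₂) : ℕ) : ℝ) / Q ^ 2) / u₁),
            Real.exp (-(u₁ + u₂)) / (1 - Real.exp (-(u₁ + u₂))) ^ 2 * Real.log u₂) +
        ∫ u₁ in Ioi (0 : ℝ), ∫ u₂ in Ioi ((((g * g * (k₁ * k₂) : ℕ) : ℝ) / Q ^ 2) / u₁),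
            Real.exp (-(u₁ + u₂)) / (1 - Real.exp (-(u₁ + u₂))) ^ 2 * Real.log u₂ ^ 2) := by
  rw [heckeSum_order_eq 0 2 hQ hg hk₁.ne_zero hk₂.ne_zero]
  simp only [Finset.sum_range_succ, Finset.sum_range_zero, zero_add, Nat.sub_self, Nat.sub_zero,
    Nat.choose_zero_right, Nat.choose_self, Nat.choose_one_right, Nat.succ_sub_succ_eq_sub,
    centralMoment_zero, centralMoment_one, centralMoment_two_of_squarefree hk₁, centralMoment_two_of_squarefree hk₂]
  simp only [pow_zero, pow_one, one_mul, mul_one]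
  push_cast
  ring

/-- **Order `(2,2)` (rung 2)**: `Σ_{d,e}𝔚₂₂ = τ(k₁)τ(k₂)·{(L⁴ − 2L²S₂ + 3S₂² − 2S₄)/16·c₀₀ + (L³ − LS₂)/4·(c₀₁ + c₁₀)
+ (L² + S₂)/4·(c₀₂ + c₂₀) + (L² − S₂)·c₁₁ + L·(c₁₂ + c₂₁) + c₂₂}(g²k₁k₂/Q²)` (`Q > 0`, `g ≥ 1`, squarefree `k₁, k₂`).
[cite: KowalskiMichelVanderKam2000, (23)–(28) — derivation] -/
theorem heckeSum_orderTwoTwo_eq {Q : ℝ} (hQ : 0 < Q) {g k₁ k₂ : ℕ} (hg : g ≠ 0) (hk₁ : Squarefree k₁)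
    (hk₂ : Squarefree k₂) :
    ∑ d ∈ k₁.divisors, ∑ e ∈ k₂.divisors,
        ∫ u₁ in Ioi (0 : ℝ),
          (Real.log (Q / ((k₁ / d * (g * e) : ℕ) : ℝ)) + Real.log u₁) ^ 2 *
          ∫ u₂ in Ioi ((((k₁ / d * (g * e) * (g * d * (k₂ / e)) : ℕ) : ℝ) / Q ^ 2) / u₁),
            Real.exp (-(u₁ + u₂)) / (1 - Real.exp (-(u₁ + u₂))) ^ 2 *
            (Real.log (Q / ((g * d * (k₂ / e) : ℕ) : ℝ)) + Real.log u₂) ^ 2 =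
      (k₁.divisors.card : ℝ) * (k₂.divisors.card : ℝ) *
        (((2 * (Real.log Q - Real.log g) - Real.log k₁ - Real.log k₂) ^ 4 -
            2 * (2 * (Real.log Q - Real.log g) - Real.log k₁ - Real.log k₂) ^ 2 *
              ((∑ p ∈ k₁.primeFactors, Real.log p ^ 2) + ∑ p ∈ k₂.primeFactors, Real.log p ^ 2) +
            3 * ((∑ p ∈ k₁.primeFactors, Real.log p ^ 2) + ∑ p ∈ k₂.primeFactors, Real.log p ^ 2) ^ 2 -
            2 * ((∑ p ∈ k₁.primeFactors, Real.log p ^ 4) + ∑ p ∈ k₂.primeFactors, Real.log p ^ 4)) / 16 *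
          (∫ u₁ in Ioi (0 : ℝ), ∫ u₂ in Ioi ((((g * g * (k₁ * k₂) : ℕ) : ℝ) / Q ^ 2) / u₁),
            Real.exp (-(u₁ + u₂)) / (1 - Real.exp (-(u₁ + u₂))) ^ 2) +
        ((2 * (Real.log Q - Real.log g) - Real.log k₁ - Real.log k₂) ^ 3 -
            (2 * (Real.log Q - Real.log g) - Real.log k₁ - Real.log k₂) *
              ((∑ p ∈ k₁.primeFactors, Real.log p ^ 2) + ∑ p ∈ k₂.primeFactors, Real.log p ^ 2)) / 4 *
          ((∫ u₁ in Ioi (0 : ℝ), ∫ u₂ in Ioi ((((g * g * (k₁ * k₂) : ℕ) : ℝ) / Q ^ 2) / u₁),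
              Real.exp (-(u₁ + u₂)) / (1 - Real.exp (-(u₁ + u₂))) ^ 2 * Real.log u₂) +
            ∫ u₁ in Ioi (0 : ℝ), Real.log u₁ * ∫ u₂ in Ioi ((((g * g * (k₁ * k₂) : ℕ) : ℝ) / Q ^ 2) / u₁),
              Real.exp (-(u₁ + u₂)) / (1 - Real.exp (-(u₁ + u₂))) ^ 2) +
        ((2 * (Real.log Q - Real.log g) - Real.log k₁ - Real.log k₂) ^ 2 +
            ((∑ p ∈ k₁.primeFactors, Real.log p ^ 2) + ∑ p ∈ k₂.primeFactors, Real.log p ^ 2)) / 4 *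
          ((∫ u₁ in Ioi (0 : ℝ), ∫ u₂ in Ioi ((((g * g * (k₁ * k₂) : ℕ) : ℝ) / Q ^ 2) / u₁),
              Real.exp (-(u₁ + u₂)) / (1 - Real.exp (-(u₁ + u₂))) ^ 2 * Real.log u₂ ^ 2) +
            ∫ u₁ in Ioi (0 : ℝ), Real.log u₁ ^ 2 * ∫ u₂ in Ioi ((((g * g * (k₁ * k₂) : ℕ) : ℝ) / Q ^ 2) / u₁),
              Real.exp (-(u₁ + u₂)) / (1 - Real.exp (-(u₁ + u₂))) ^ 2) +
        ((2 * (Real.log Q - Real.log g) - Real.log k₁ - Real.log k₂) ^ 2 -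
            ((∑ p ∈ k₁.primeFactors, Real.log p ^ 2) + ∑ p ∈ k₂.primeFactors, Real.log p ^ 2)) *
          (∫ u₁ in Ioi (0 : ℝ), Real.log u₁ * ∫ u₂ in Ioi ((((g * g * (k₁ * k₂) : ℕ) : ℝ) / Q ^ 2) / u₁),
            Real.exp (-(u₁ + u₂)) / (1 - Real.exp (-(u₁ + u₂))) ^ 2 * Real.log u₂) +
        (2 * (Real.log Q - Real.log g) - Real.log k₁ - Real.log k₂) *
          ((∫ u₁ in Ioi (0 : ℝ), Real.log u₁ * ∫ u₂ in Ioi ((((g * g * (k₁ * k₂) : ℕ) : ℝ) / Q ^ 2) / u₁),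
              Real.exp (-(u₁ + u₂)) / (1 - Real.exp (-(u₁ + u₂))) ^ 2 * Real.log u₂ ^ 2) +
            ∫ u₁ in Ioi (0 : ℝ), Real.log u₁ ^ 2 * ∫ u₂ in Ioi ((((g * g * (k₁ * k₂) : ℕ) : ℝ) / Q ^ 2) / u₁),
              Real.exp (-(u₁ + u₂)) / (1 - Real.exp (-(u₁ + u₂))) ^ 2 * Real.log u₂) +
        ∫ u₁ in Ioi (0 : ℝ), Real.log u₁ ^ 2 * ∫ u₂ in Ioi ((((g * g * (k₁ * k₂) : ℕ) : ℝ) / Q ^ 2) / u₁),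
            Real.exp (-(u₁ + u₂)) / (1 - Real.exp (-(u₁ + u₂))) ^ 2 * Real.log u₂ ^ 2) := by
  rw [heckeSum_order_eq 2 2 hQ hg hk₁.ne_zero hk₂.ne_zero]
  simp only [Finset.sum_range_succ, Finset.sum_range_zero, zero_add, Nat.sub_self, Nat.sub_zero,
    Nat.choose_zero_right, Nat.choose_self, Nat.choose_one_right, Nat.succ_sub_succ_eq_sub,
    centralMoment_zero, centralMoment_one, centralMoment_three,
    centralMoment_two_of_squarefree hk₁, centralMoment_two_of_squarefree hk₂,
    centralMoment_four_of_squarefree hk₁, centralMoment_four_of_squarefree hk₂]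
  simp only [pow_zero, pow_one, one_mul, mul_one, Nat.choose]
  push_cast
  ring

end Summit.Parity.GeneralizedHardyLittlewood.Theorems.MomentsBeyondDiagonal.DiagKernel

end
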